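import Literature.AnabelianGeometry.SemiGraphs.TemperedCompactInVerticialFinite
import HarnessLib

/-!
# The compact-form finite-level data of the tempered fundamental group chart, as named data ([SemiAnbd] Thm 3.7 (iii), p. 41)

Mochizuki, *Semi-graphs of anabelioids*, Publ. RIMS **42** (2006) [MochizukiSemiAnbd2006], proof of
Thm. 3.7 (iii) p. 41 with the author's *Comments* (2020) item (6).

Companion of `TemperedCompactInVerticialFinite.lean` (seat abc-iut-L3-t8 gen 4, row (β)-ASM): the same
compact-form finite-level data `FiniteLevelDataCpt` of the constructed chart `𝒢.temperedPiChart` — there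
packaged as an existence statement for the proof lane — here as a NAMED structure-valued definition
(`finiteLevelDataCpt_temperedPiChart`), for consumers that need the data themselves (the level
dictionary / (β)-2 rows, the witness rows): the Galois tower of Prop. 3.6 (`finiteLevelDataCptOfTower`)
fed with (I1)–(I3) (`fix_/stab_/edge_temperedPiChart`) and (I4′)_cpt (`stabBranchPairCpt'_temperedPiChart`
with (I0v) `galoisLevelData_faithfulV`).  Nothing here bears on [IUTchIII] Cor. 3.12.
-/

namespace Literature.AnabelianGeometry.SemiGraphs

namespace ProfiniteSemiGraph

open CategoryTheory Topology

universe u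

variable (𝒢 : ProfiniteSemiGraph.{u})

/-- **The compact-form finite-level data of the tempered fundamental group chart** of a finite `𝒢`
satisfying the hypotheses of Thm. 3.7 (named form of `exists_finiteLevelDataCpt_of_finite`).
[cite: MochizukiSemiAnbd2006, Thm 3.7(iii) p.41] -/
noncomputable def finiteLevelDataCpt_temperedPiChart (h37 : 𝒢.Thm37Hypotheses) [Finite 𝒢.graph.Vertex]
    [Finite 𝒢.graph.Edge] : FiniteLevelDataCpt.{0} 𝒢 (𝒢.temperedPiChart h37.toProp36Hypotheses) :=
  (𝒢.galoisLevelData h37.toProp36Hypotheses).finiteLevelDataCptOfTower h37.toProp36Hypotheses.isCountable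
    (𝒢.temperedPiChart h37.toProp36Hypotheses) (MonoidHom.id _)
    (𝒢.galoisLevelData_hconn h37.toProp36Hypotheses) (𝒢.galoisLevelData_isFinite h37.toProp36Hypotheses)
    continuous_id fix_temperedPiChart stab_temperedPiChart edge_temperedPiChart
    (𝒢.stabBranchPairCpt'_temperedPiChart h37.toProp36Hypotheses (galoisLevelData_faithfulV 𝒢 h37))

/-- Its tree-level part is the landed `verticialLevelData_temperedPiChart` ((β)-1).
[cite: MochizukiSemiAnbd2006, Thm 3.7(iii) p.41] -/
theorem finiteLevelDataCpt_temperedPiChart_toVerticialLevelData (h37 : 𝒢.Thm37Hypotheses)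
    [Finite 𝒢.graph.Vertex] [Finite 𝒢.graph.Edge] :
    (𝒢.finiteLevelDataCpt_temperedPiChart h37).toVerticialLevelData =
      verticialLevelData_temperedPiChart (h36 := h37.toProp36Hypotheses) := rfl

/-- Its finite levels are the orbit graphs `𝔾_{S n}` of the tower levels.
[cite: MochizukiSemiAnbd2006, Thm 3.7(iii) p.41] -/
theorem finiteLevelDataCpt_temperedPiChart_level (h37 : 𝒢.Thm37Hypotheses) [Finite 𝒢.graph.Vertex]
    [Finite 𝒢.graph.Edge] (n : ℕ) :
    (𝒢.finiteLevelDataCpt_temperedPiChart h37).level n =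
      ((𝒢.galoisLevelData h37.toProp36Hypotheses).S n).orbitGraph := rfl

end ProfiniteSemiGraph

end Literature.AnabelianGeometry.SemiGraphs
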